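import Summits.BirchSwinnertonDyer.BirchSwinnertonDyer.Theorems.TwoAdicConverseOrdLambdaHalfAtTwoBDPTwoVariableDefs
import HarnessLib

/-!
# Line `special_fibre_square_two` for crux O2 = `BDPSelmerLowerDivisibilityAtTwo` (item stmt-BirchSwinnertonDyer-24728)

Crux-ideate round 1, seat 1 (planner-cruxidea-stmt-BirchSwinnertonDyer-24728-1).  BSD is proved for no curve by
any of this; typed ≠ proved; every `stub_*` below is OPEN research unless marked otherwise.

THE NODE (D-0171).  O2 as typed (integral two-variable Greenberg lower inclusion at `2`, exact `h_K` slot) is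

  O2 ⟸ O2♭ ∧ INT2 ∧ UMZ2 ∧ SAT(alg)     (`NodeO2`/`nodeO2` kernel; `BDPSelmerLowerDivisibilityAtTwo_of` = composition with the stubs)

* O2♭ = `TwoPowerSlackLowerInclusionAtTwo` — VERBATIM the cell's pre-declared fallback
  `…Cruxes.OrdLambdaHalfAtTwo.KatoDeterminantGreenbergTwo.BDPSelmerLowerDivisibilityAtTwoRat` (evidence
  NOTE-24728-O2-rider-fallback 6585b289a7015cc9; restated here because `Cruxes/` files are not importable):
  `2^b · ch(X_Gr)·Λ^ur ⊆ (G♭)` with `G♭` interpolating `2^a ·` the Yan–Zhu values.  Leaf tag: BARRIER / IDEA-NEEDED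
  (a two-variable lower inclusion for a non-CM `f` has only ever come from an Euler system — Beilinson–Flach,
  Heegner/Howard, diagonal cycles — and none is in print for residually REDUCIBLE `f` at any `p`, let alone `p = 2`).
* INT2 = `GreenbergFunctionIntegralAtTwo` — every `2^a`-scaled frame DESCENDS: the `h_K`-normalised Greenberg
  function `G₀` exists in `𝒪_{ℂ₂}⟦T₁,T₂⟧` and `G♭ = 2^a · G₀`.  Leaf tag: INSTRUMENTABLE (2-adic valuations of
  CM-period-normalised BDP values of a (β) curve at in-range characters; Kriz–Li work with `𝓛_BDP` at `p = 2`).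
* SAT2 = `GreenbergFunctionSaturatedAtTwo` — the ideal `(G₀)` is `2`-saturated in `𝒪_{ℂ₂}⟦T₁⟧⟦T₂⟧` — DERIVED
  (kernel) from stub C1 = UMZ2 (`GreenbergFunctionUnrMuZeroAtTwo`: `G₀` is `𝒪^ur`-integral with `μ = 0`, in the
  subring-free currency `UnrDichotomyMuZero`) and stub C2 = SAT(alg) (`SaturatedOfUnrDichotomy`, pure algebra);
  the `μ = 0` half of UMZ2 ⟸ AN2 (the residual SQUARE congruence `Ḡ₀ = ū·𝓔̄²·(𝓛̄_v^{Katz})²` in `𝔽̄₂⟦T₁,T₂⟧`, research) ∧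
  `μ(𝓛_v^{Katz}) = 0` at `2` (PRINT: Oukhaba–Viguié 2015, Crişan–Müller 2020).  Leaf tags: ATTACKABLE (algebra) /
  INSTRUMENTABLE (AN2).

THE IDEA (special fibre square, §3, typed as `ResidualSquareAtTwo` = RES2): over the `ℤ₂²`-tower `K̃_∞` the
residual representation is `E[2]^ss = 𝟙 ⊕ 𝟙`, the special fibre `Λ̄ = 𝔽̄₂⟦T₁,T₂⟧` of `Λ_K^ur` has dimension TWO, so
every FINITE piece of glue (`E(K̃_∞)[2] ≠ 0`, local `H⁰` at `v̄`) is pseudo-null THERE (it is `λ`-visible over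
`𝔽̄₂⟦T⟧`, which is what kills the one-variable GV/CGLS/GL(1)-count roads at `2`), and the residual dévissage gives
`(ch X_Gr)‾ = ū · (Q̄_v)²` with `Q_v` the characteristic series of the `v`-ramified Iwasawa module of `K` over
`K̃_∞` — a GL(1) object whose main conjecture at `p = 2` IS in print (Müller, arXiv:2002.05647 Thm 1.1; Viguié 2013;
Crişan–Müller 2020).  With AN2 this is the residual two-variable main conjecture RES2, which gives the TORSION
conjunct of O2, `μ(X_Gr) = 0` and MU2 for free, and — restricted to the cyclotomic line by char-0 specialisation
(SPEC) — the EXACT numerical equality `λ(X_Gr,cyc) = λ(G₀|_cyc)`, `μ = 0` on both sides (CNE), which is all the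
route's 6‴ consumes of O2.  RES2 does NOT give O2♭ (residual equality + one line ⇏ two-variable ideal inclusion:
`A = T₁ − 2uT₂`, `B = T₁`).  Recommended recut for the lead of 19556 (write-protected from this seat):
(O1, O2) → (O1|cyc : CNE → ThetaDivisibilityAt, CNE ⟸ RES2 ∧ SPEC) — no two-variable Euler system anywhere.
-/

open scoped Classical NumberField
open WeierstrassCurve NumberField IsDedekindDomain Field CategoryTheory Function PowerSeries CongruenceSubgroup
open Literature.NumberTheory.EllipticCurves Literature.NumberTheory.EllipticCurves.Rank1Residual
open Literature.NumberTheory.EllipticCurves.ModularForms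
open Literature.NumberTheory.EllipticCurves.Kato2004 Literature.NumberTheory.EllipticCurves.Kato2004.EulerSystemValues
open Literature.NumberTheory.GaloisRepresentations
open Literature.NumberTheory.EllipticCurves.IwasawaAlgebra₂ Literature.NumberTheory.EllipticCurves.UnrSeries₂
open Literature.NumberTheory.EllipticCurves.GreenbergVatsal2000
open Literature.NumberTheory.EllipticCurves.BurungaleCastellaSkinner2025
open Literature.NumberTheory.EllipticCurves.YanZhu2026
open Summit.BirchSwinnertonDyer.BirchSwinnertonDyer.Theorems.TwoAdicKatoDeterminant

namespace Summit.BirchSwinnertonDyer.BirchSwinnertonDyer.Cruxes.BDPSelmerLowerDivisibilityAtTwo.SpecialFibreSquareTwo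

/-! ## §0 The receptacle and its special fibre -/

/-- The receptacle `Λ_K^ur ⊗ 𝒪_{ℂ₂} = 𝒪_{ℂ₂}⟦T₁⟧⟦T₂⟧` of the route's O2 frame. -/
abbrev Rcpt : Type := PowerSeries (PowerSeries (PadicComplexInt 2))

/-- Its SPECIAL FIBRE `𝔽̄₂⟦T₁⟧⟦T₂⟧` (`𝔽̄₂` := residue field of the valuation ring `𝒪_{ℂ₂}`). -/
abbrev SpecialFibre : Type := PowerSeries (PowerSeries (IsLocalRing.ResidueField (PadicComplexInt 2)))

/-- Reduction to the special fibre, coefficientwise. [folklore] -/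
noncomputable def red₂ : Rcpt →+* SpecialFibre :=
  PowerSeries.map (PowerSeries.map (IsLocalRing.residue (PadicComplexInt 2)))

/-! ## §1 The pieces of the node for O2 AS TYPED, at a datum `(W, K)` -/

/-- **O2♭ at `(W, K)`** — verbatim `KatoDeterminantGreenbergTwo.GreenbergLowerInclusionRatAt` (lead's fallback file
`Cruxes/OrdLambdaHalfAtTwo/Lines/kato_determinant_greenberg_two_O2RatFallback.lean` §1): the frame with class-number
slot `2^a · h_K` and the inclusion `2^b · ch(X_Gr)·Λ^ur ⊆ (G)`.
[cite: YanZhu2024MainConjNonCM, Thm. 4.2 (2), Thm. 4.7 (1) (arXiv:2412.20078v4)] [cite: BurungaleCastellaSkinner2025, Conj. 4.1.2] -/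
def GreenbergLowerInclusionRatAt (W : WeierstrassCurve ℚ) [W.IsElliptic] [W.IsGloballyMinimal]
    (K : Type) [Field K] [NumberField K] : Prop :=
  ∀ [IsCMField K] (ι : PadicAlgCl 2 ≃+* ℂ) (v vbar : HeightOneSpectrum (𝓞 K)) (κ₁ κ₂ : ZpExtension K 2)
    (γ₁ γ₂ : absoluteGaloisGroup K) [Fact (ZpExtension.IsTopGeneratorPair κ₁ κ₂ γ₁ γ₂)]
    [NeZero (W.conductorNorm ℤ)] (f : CuspForm (Gamma0 (W.conductorNorm ℤ)) 2),
    ModularForms.IsNewformOf W f → ∀ [NeZero (NumberField.discr K).natAbs],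
    ((2 : ℕ) : 𝓞 K) ∈ v.asIdeal → ((2 : ℕ) : 𝓞 K) ∈ vbar.asIdeal → vbar ≠ v →
    (∀ (w : InfinitePlace K) (k : 𝓞 K), k ∈ v.asIdeal ↔ ‖ι.symm (w.embedding (k : K))‖ < 1) →
    ∃ (a b : ℕ) (Ω δ : ℂ) (Ωp : (unrIntegers 2)ˣ) (LK G : Rcpt),
      Ω ≠ 0 ∧ (δ ^ 2 = (NumberField.discr K : ℂ) ∨ δ ^ 2 = -(NumberField.discr K : ℂ)) ∧
      IsKatzMeasure₂ ι v vbar ∅ κ₁ κ₂ γ₁⁻¹ γ₂⁻¹ 1 Ω δ ((Ωp : unrIntegers 2) : ℂ_[2]) LK ∧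
      IsGreenbergLFunctionFree₂ ι v vbar κ₁ κ₂ γ₁⁻¹ γ₂⁻¹ f (NumberField.discr K).natAbs
        (2 ^ a * NumberField.classNumber K) LK G ∧
      Module.IsTorsion (IwasawaAlgebra₂ 2) ((W.baseChange K).XGr₂ 2 κ₁ κ₂ vbar γ₁ γ₂) ∧
      ∀ J : ℤ_[2] →+* PadicComplexInt 2,
        (∀ x : ℤ_[2], ((J x : PadicComplexInt 2) : ℂ_[2]) = ((x : ℚ_[2]) : ℂ_[2])) →
        Ideal.span {(2 : Rcpt) ^ b} *
            (WeierstrassCurve.XGr₂.charIdeal (W.baseChange K) 2 κ₁ κ₂ vbar γ₁ γ₂).map (toUnr₂ 2 J) ≤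
          Ideal.span {G}

/-- **INT2 at `(W, K)` — two-power DESCENT of the Greenberg frame.**  Every coordinate-free Greenberg `2`-adic
`L`-function `G` framed with the scaled class-number slot `2^a · h_K` (so interpolating `2^a ·` the Yan–Zhu Def. 3.11
values) is `2^a · G₀` for a series `G₀ ∈ 𝒪_{ℂ₂}⟦T₁⟧⟦T₂⟧` framed with the EXACT slot `h_K`.  Content: the
`h_K`/CM-period-normalised values are `2`-adically INTEGRAL (the W38 rider's question); the equation `G = 2^a · G₀`
then follows from the two-variable identity principle (`eq_of_hasValueAt₂_eq_fibred_torsion`).  Research at `2`;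
INSTRUMENTABLE (valuations of finitely many normalised BDP values decide nothing but refute cheaply).
[cite: YanZhu2024MainConjNonCM, Def. 3.11] [cite: CastellaGrossiSkinner2025, Thm. 2.4.1] -/
def GreenbergFunctionIntegralAt (W : WeierstrassCurve ℚ) [W.IsElliptic] [W.IsGloballyMinimal]
    (K : Type) [Field K] [NumberField K] : Prop :=
  ∀ [IsCMField K] (ι : PadicAlgCl 2 ≃+* ℂ) (v vbar : HeightOneSpectrum (𝓞 K)) (κ₁ κ₂ : ZpExtension K 2)
    (γ₁ γ₂ : absoluteGaloisGroup K) [Fact (ZpExtension.IsTopGeneratorPair κ₁ κ₂ γ₁ γ₂)]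
    [NeZero (W.conductorNorm ℤ)] (f : CuspForm (Gamma0 (W.conductorNorm ℤ)) 2),
    ModularForms.IsNewformOf W f → ∀ [NeZero (NumberField.discr K).natAbs],
    ((2 : ℕ) : 𝓞 K) ∈ v.asIdeal → ((2 : ℕ) : 𝓞 K) ∈ vbar.asIdeal → vbar ≠ v →
    (∀ (w : InfinitePlace K) (k : 𝓞 K), k ∈ v.asIdeal ↔ ‖ι.symm (w.embedding (k : K))‖ < 1) →
    ∀ (a : ℕ) (Ω δ : ℂ) (Ωp : (unrIntegers 2)ˣ) (LK G : Rcpt),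
      IsKatzMeasure₂ ι v vbar ∅ κ₁ κ₂ γ₁⁻¹ γ₂⁻¹ 1 Ω δ ((Ωp : unrIntegers 2) : ℂ_[2]) LK →
      IsGreenbergLFunctionFree₂ ι v vbar κ₁ κ₂ γ₁⁻¹ γ₂⁻¹ f (NumberField.discr K).natAbs
        (2 ^ a * NumberField.classNumber K) LK G →
      ∃ G₀ : Rcpt,
        IsGreenbergLFunctionFree₂ ι v vbar κ₁ κ₂ γ₁⁻¹ γ₂⁻¹ f (NumberField.discr K).natAbs
          (NumberField.classNumber K) LK G₀ ∧
        G = (2 : Rcpt) ^ a * G₀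

/-- **The unramified dichotomy with `μ = 0`** for a series `G₀ ∈ 𝒪_{ℂ₂}⟦T₁⟧⟦T₂⟧`: every coefficient is a UNIT of
`𝒪_{ℂ₂}` or DIVISIBLE BY `2`, and at least one is a unit.  Holds for (the image of) any series over the unramified
DVR `W(𝔽̄₂) = 𝒪^ur` (uniformiser `2`) with nonzero reduction mod `2` — the natural home of Katz / Hida–BDP measures.
[cite: GreenbergVatsal2000, p. 2, (1)–(2)] -/
def UnrDichotomyMuZero (G₀ : Rcpt) : Prop :=
  (∀ n m : ℕ, IsUnit (PowerSeries.coeff m (PowerSeries.coeff n G₀)) ∨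
      (2 : PadicComplexInt 2) ∣ PowerSeries.coeff m (PowerSeries.coeff n G₀)) ∧
    ∃ n m : ℕ, IsUnit (PowerSeries.coeff m (PowerSeries.coeff n G₀))

/-- **UMZ2 at `(W, K)` — the exact Greenberg frame is `𝒪^ur`-INTEGRAL with `μ = 0`** (in the subring-free currency
`UnrDichotomyMuZero`): for every frame `(LK, G₀)` with the exact class-number slot.  Two contents: (i) RATIONALITY —
`G₀` has coefficients in `W(𝔽̄₂)` (construction-level: the Katz and Hida/BDP measures are `𝒪^ur`-valued; to be
RECORDED at `2`, cf. the lead's sharpen (30)); (ii) analytic `μ(G₀) = 0` at `2` ⟸ the residual square congruence AN2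
(`Ḡ₀ = ū·𝓔̄²·(𝓛̄_v^{Katz})²`, research at `2`; CGLS Thm 2.2.1 / Kriz 2016 give it for `p` odd) ∧ `μ(𝓛_v^{Katz}) = 0`
at `2` (PRINT: Oukhaba–Viguié 2015 Forum Math. doi:10.1515/forum-2013-0194; Crişan–Müller 2020
doi:10.4310/ajm.2020.v24.n2.a5).  (ii) is also the `red₂ G₀ ≠ 0` conjunct of RES2 (§3).  Research at `2`; INSTRUMENTABLE.
[cite: CastellaGrossiLeeSkinner2022, Thm. 2.2.1 (shape of AN2, p odd there)] [cite: GreenbergVatsal2000, p. 2, (2)] -/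
def GreenbergFunctionUnrMuZeroAt (W : WeierstrassCurve ℚ) [W.IsElliptic] [W.IsGloballyMinimal]
    (K : Type) [Field K] [NumberField K] : Prop :=
  ∀ [IsCMField K] (ι : PadicAlgCl 2 ≃+* ℂ) (v vbar : HeightOneSpectrum (𝓞 K)) (κ₁ κ₂ : ZpExtension K 2)
    (γ₁ γ₂ : absoluteGaloisGroup K) [Fact (ZpExtension.IsTopGeneratorPair κ₁ κ₂ γ₁ γ₂)]
    [NeZero (W.conductorNorm ℤ)] (f : CuspForm (Gamma0 (W.conductorNorm ℤ)) 2),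
    ModularForms.IsNewformOf W f → ∀ [NeZero (NumberField.discr K).natAbs],
    ((2 : ℕ) : 𝓞 K) ∈ v.asIdeal → ((2 : ℕ) : 𝓞 K) ∈ vbar.asIdeal → vbar ≠ v →
    (∀ (w : InfinitePlace K) (k : 𝓞 K), k ∈ v.asIdeal ↔ ‖ι.symm (w.embedding (k : K))‖ < 1) →
    ∀ (Ω δ : ℂ) (Ωp : (unrIntegers 2)ˣ) (LK G₀ : Rcpt),
      IsKatzMeasure₂ ι v vbar ∅ κ₁ κ₂ γ₁⁻¹ γ₂⁻¹ 1 Ω δ ((Ωp : unrIntegers 2) : ℂ_[2]) LK →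
      IsGreenbergLFunctionFree₂ ι v vbar κ₁ κ₂ γ₁⁻¹ γ₂⁻¹ f (NumberField.discr K).natAbs
        (NumberField.classNumber K) LK G₀ →
      UnrDichotomyMuZero G₀

/-- **SAT(alg) — two-saturation from the unramified dichotomy (PURE ALGEBRA, ATTACKABLE now).**  If every
coefficient of `G₀` is a unit or a multiple of `2` and one is a unit, then `2·X ∈ (G₀) → X ∈ (G₀)` in
`𝒪_{ℂ₂}⟦T₁⟧⟦T₂⟧`.  Proof sketch (no noetherianity needed): write `2X = G₀Y`; if some coefficient of `Y` is not in
`2𝒪_{ℂ₂}`, take the lex-minimal such index `(b₀,d₀)` and the lex-minimal index `(a₀,c₀)` with `g_{a₀c₀}` a unit; the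
coefficient of `G₀Y` at `(a₀+b₀, c₀+d₀)` is `≡ g_{a₀c₀} y_{b₀d₀} (mod 2)` (every other term has a factor `2 ∣ g`
or `2 ∣ y` by the two minimalities), contradiction; so `Y = 2Y'` and cancel `2` in the domain.  [folklore] -/
def SaturatedOfUnrDichotomy : Prop :=
  ∀ G₀ : Rcpt, UnrDichotomyMuZero G₀ → ∀ X : Rcpt, 2 * X ∈ Ideal.span {G₀} → X ∈ Ideal.span {G₀}

/-- **SAT2 at `(W, K)` — the exact Greenberg frame is `2`-SATURATED**: for every frame `(LK, G₀)` with the exact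
class-number slot, `2·X ∈ (G₀) → X ∈ (G₀)` in `𝒪_{ℂ₂}⟦T₁⟧⟦T₂⟧`.  Derived below from UMZ2 and SAT(alg)
(`greenbergFunctionSaturatedAt_of`); kept as a named `Prop` because it is exactly what the composition consumes.
[cite: GreenbergVatsal2000, p. 2, (1)–(2)] -/
def GreenbergFunctionSaturatedAt (W : WeierstrassCurve ℚ) [W.IsElliptic] [W.IsGloballyMinimal]
    (K : Type) [Field K] [NumberField K] : Prop :=
  ∀ [IsCMField K] (ι : PadicAlgCl 2 ≃+* ℂ) (v vbar : HeightOneSpectrum (𝓞 K)) (κ₁ κ₂ : ZpExtension K 2)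
    (γ₁ γ₂ : absoluteGaloisGroup K) [Fact (ZpExtension.IsTopGeneratorPair κ₁ κ₂ γ₁ γ₂)]
    [NeZero (W.conductorNorm ℤ)] (f : CuspForm (Gamma0 (W.conductorNorm ℤ)) 2),
    ModularForms.IsNewformOf W f → ∀ [NeZero (NumberField.discr K).natAbs],
    ((2 : ℕ) : 𝓞 K) ∈ v.asIdeal → ((2 : ℕ) : 𝓞 K) ∈ vbar.asIdeal → vbar ≠ v →
    (∀ (w : InfinitePlace K) (k : 𝓞 K), k ∈ v.asIdeal ↔ ‖ι.symm (w.embedding (k : K))‖ < 1) →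
    ∀ (Ω δ : ℂ) (Ωp : (unrIntegers 2)ˣ) (LK G₀ : Rcpt),
      IsKatzMeasure₂ ι v vbar ∅ κ₁ κ₂ γ₁⁻¹ γ₂⁻¹ 1 Ω δ ((Ωp : unrIntegers 2) : ℂ_[2]) LK →
      IsGreenbergLFunctionFree₂ ι v vbar κ₁ κ₂ γ₁⁻¹ γ₂⁻¹ f (NumberField.discr K).natAbs
        (NumberField.classNumber K) LK G₀ →
      ∀ X : Rcpt, 2 * X ∈ Ideal.span {G₀} → X ∈ Ideal.span {G₀}

/-- UMZ2 ∧ SAT(alg) ⟹ SAT2 at every datum (kernel). [folklore] -/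
theorem greenbergFunctionSaturatedAt_of {W : WeierstrassCurve ℚ} [W.IsElliptic] [W.IsGloballyMinimal]
    {K : Type} [Field K] [NumberField K] (h : GreenbergFunctionUnrMuZeroAt W K) (halg : SaturatedOfUnrDichotomy) :
    GreenbergFunctionSaturatedAt W K := by
  intro _ ι v vbar κ₁ κ₂ γ₁ γ₂ _ _ f hf _ hv hvbar hne hι Ω δ Ωp LK G₀ hLK hG₀
  exact halg G₀ (h ι v vbar κ₁ κ₂ γ₁ γ₂ f hf hv hvbar hne hι Ω δ Ωp LK G₀ hLK hG₀)

/-! ## §2 The same pieces on the habitat of O2 (branch (β): non-CM, good ordinary at `2`, `E[2]` reducible; `K`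
imaginary quadratic with the Heegner hypothesis for `2N`) -/

/-- **O2♭** = verbatim `KatoDeterminantGreenbergTwo.BDPSelmerLowerDivisibilityAtTwoRat` (the pre-declared restatement of
item 24728 with `2`-power slack).  Research, NOT in print at `2`. [cite: YanZhu2024MainConjNonCM, Thm. 4.2 (2)] -/
def TwoPowerSlackLowerInclusionAtTwo : Prop :=
  ∀ (W : WeierstrassCurve ℚ) [W.IsElliptic] [W.IsGloballyMinimal],
    ¬ W.HasCM → GoodOrd W 2 → ¬ W.HasIrreducibleModPGaloisRep 2 →
    ∀ (K : Type) [Field K] [NumberField K],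
      (IsImaginaryQuadratic K ∧ SatisfiesHeegnerHypothesis (2 * W.conductorNorm ℤ) K) →
      GreenbergLowerInclusionRatAt W K

/-- **INT2** on the habitat. Research at `2`; INSTRUMENTABLE. [cite: YanZhu2024MainConjNonCM, Def. 3.11] -/
def GreenbergFunctionIntegralAtTwo : Prop :=
  ∀ (W : WeierstrassCurve ℚ) [W.IsElliptic] [W.IsGloballyMinimal],
    ¬ W.HasCM → GoodOrd W 2 → ¬ W.HasIrreducibleModPGaloisRep 2 →
    ∀ (K : Type) [Field K] [NumberField K],
      (IsImaginaryQuadratic K ∧ SatisfiesHeegnerHypothesis (2 * W.conductorNorm ℤ) K) →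
      GreenbergFunctionIntegralAt W K

/-- **UMZ2** on the habitat (stub C1). Research at `2`; INSTRUMENTABLE. [cite: GreenbergVatsal2000, p. 2, (2)] -/
def GreenbergFunctionUnrMuZeroAtTwo : Prop :=
  ∀ (W : WeierstrassCurve ℚ) [W.IsElliptic] [W.IsGloballyMinimal],
    ¬ W.HasCM → GoodOrd W 2 → ¬ W.HasIrreducibleModPGaloisRep 2 →
    ∀ (K : Type) [Field K] [NumberField K],
      (IsImaginaryQuadratic K ∧ SatisfiesHeegnerHypothesis (2 * W.conductorNorm ℤ) K) →
      GreenbergFunctionUnrMuZeroAt W K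

/-- **SAT2** on the habitat (derived: UMZ2 ∧ SAT(alg)). [cite: GreenbergVatsal2000, p. 2, (2)] -/
def GreenbergFunctionSaturatedAtTwo : Prop :=
  ∀ (W : WeierstrassCurve ℚ) [W.IsElliptic] [W.IsGloballyMinimal],
    ¬ W.HasCM → GoodOrd W 2 → ¬ W.HasIrreducibleModPGaloisRep 2 →
    ∀ (K : Type) [Field K] [NumberField K],
      (IsImaginaryQuadratic K ∧ SatisfiesHeegnerHypothesis (2 * W.conductorNorm ℤ) K) →
      GreenbergFunctionSaturatedAt W K

/-- UMZ2 ∧ SAT(alg) ⟹ SAT2 on the habitat (kernel). [folklore] -/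
theorem greenbergFunctionSaturatedAtTwo_of (h : GreenbergFunctionUnrMuZeroAtTwo) (halg : SaturatedOfUnrDichotomy) :
    GreenbergFunctionSaturatedAtTwo :=
  fun W _ _ hCM hGO hβ K _ _ hK => greenbergFunctionSaturatedAt_of (h W hCM hGO hβ K hK) halg

/-! ## §3 The special fibre square: RES2 (typed), the lever of the idea card -/

/-- **RES2 at `(W, K)` — the RESIDUAL two-variable main conjecture on the special fibre `𝔽̄₂⟦T₁⟧⟦T₂⟧`.**  For every
exact frame `(LK, G₀)` and every structure-compatible `J`: `X_Gr(E/K̃_∞)` is `Λ_K`-torsion, `G₀ mod 𝔪 ≠ 0`, and the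
reductions of `ch(X_Gr)·Λ^ur` and of `(G₀)` COINCIDE as ideals of the special fibre.  Mechanism (card
`special-fibre-square-two`): ALG2 — residual dévissage of `X_Gr ⊗ 𝔽̄₂` along `0 → 𝟙 → E[2] → 𝟙 → 0` over the
`ℤ₂²`-tower, where all finite glue is pseudo-null because `dim 𝔽̄₂⟦T₁,T₂⟧ = 2`, and the local `Ш`-defect at `v̄`
vanishes by torsion-freeness of `H¹_Iw(K̃_∞, 𝔽₂)`; GL1@2 — the `v`-ramified main conjecture for `K` at `p = 2`
(Müller, arXiv:2002.05647 Thm 1.1; Viguié 2013; Crişan–Müller 2020 `μ = 0`; Oukhaba–Viguié 2015); AN2 — the residual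
square congruence `Ḡ₀ = ū·𝓔̄²·(𝓛̄_v^{Katz})²` (research at `2`; CGLS Thm 2.2.1 / Kriz 2016 are `p` odd).  RES2
gives MU2 and the torsion conjunct of O2; it does NOT give O2♭.
[cite: CastellaGrossiLeeSkinner2022, Thm. 2.2.1 and §3.3 (p odd)] [cite: GreenbergVatsal2000, §2 Prop. (2.8) (shape)] -/
def ResidualSquareAt (W : WeierstrassCurve ℚ) [W.IsElliptic] [W.IsGloballyMinimal]
    (K : Type) [Field K] [NumberField K] : Prop :=
  ∀ [IsCMField K] (ι : PadicAlgCl 2 ≃+* ℂ) (v vbar : HeightOneSpectrum (𝓞 K)) (κ₁ κ₂ : ZpExtension K 2)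
    (γ₁ γ₂ : absoluteGaloisGroup K) [Fact (ZpExtension.IsTopGeneratorPair κ₁ κ₂ γ₁ γ₂)]
    [NeZero (W.conductorNorm ℤ)] (f : CuspForm (Gamma0 (W.conductorNorm ℤ)) 2),
    ModularForms.IsNewformOf W f → ∀ [NeZero (NumberField.discr K).natAbs],
    ((2 : ℕ) : 𝓞 K) ∈ v.asIdeal → ((2 : ℕ) : 𝓞 K) ∈ vbar.asIdeal → vbar ≠ v →
    (∀ (w : InfinitePlace K) (k : 𝓞 K), k ∈ v.asIdeal ↔ ‖ι.symm (w.embedding (k : K))‖ < 1) →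
    ∀ (Ω δ : ℂ) (Ωp : (unrIntegers 2)ˣ) (LK G₀ : Rcpt),
      IsKatzMeasure₂ ι v vbar ∅ κ₁ κ₂ γ₁⁻¹ γ₂⁻¹ 1 Ω δ ((Ωp : unrIntegers 2) : ℂ_[2]) LK →
      IsGreenbergLFunctionFree₂ ι v vbar κ₁ κ₂ γ₁⁻¹ γ₂⁻¹ f (NumberField.discr K).natAbs
        (NumberField.classNumber K) LK G₀ →
      Module.IsTorsion (IwasawaAlgebra₂ 2) ((W.baseChange K).XGr₂ 2 κ₁ κ₂ vbar γ₁ γ₂) ∧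
      red₂ G₀ ≠ 0 ∧
      ∀ J : ℤ_[2] →+* PadicComplexInt 2,
        (∀ x : ℤ_[2], ((J x : PadicComplexInt 2) : ℂ_[2]) = ((x : ℚ_[2]) : ℂ_[2])) →
        ((WeierstrassCurve.XGr₂.charIdeal (W.baseChange K) 2 κ₁ κ₂ vbar γ₁ γ₂).map (toUnr₂ 2 J)).map red₂ =
          (Ideal.span {G₀}).map red₂

/-- **RES2** on the habitat of O2. Research at `2` (ALG2 kernel-grade + GL1@2 print + AN2 research). -/
def ResidualSquareAtTwo : Prop :=
  ∀ (W : WeierstrassCurve ℚ) [W.IsElliptic] [W.IsGloballyMinimal],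
    ¬ W.HasCM → GoodOrd W 2 → ¬ W.HasIrreducibleModPGaloisRep 2 →
    ∀ (K : Type) [Field K] [NumberField K],
      (IsImaginaryQuadratic K ∧ SatisfiesHeegnerHypothesis (2 * W.conductorNorm ℤ) K) →
      ResidualSquareAt W K

/-- `red₂ G ≠ 0` ⟹ some coefficient of `G` is a unit of `𝒪_{ℂ₂}` (residue currency → unit-content currency). [folklore] -/
theorem exists_isUnit_coeff_of_red₂_ne_zero {G : Rcpt} (h : red₂ G ≠ 0) :
    ∃ n m : ℕ, IsUnit (PowerSeries.coeff m (PowerSeries.coeff n G)) := by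
  by_contra hcon
  push Not at hcon
  apply h
  ext n m
  simp only [red₂, PowerSeries.coeff_map, map_zero]
  exact (IsLocalRing.residue_eq_zero_iff _).2 (hcon n m)

/-- RES2 ⟹ the `μ = 0` half of UMZ2 at every exact frame (kernel): `red₂ G₀ ≠ 0` gives a unit coefficient. [folklore] -/
theorem exists_isUnit_coeff_of_residualSquare (h : ResidualSquareAtTwo) :
    ∀ (W : WeierstrassCurve ℚ) [W.IsElliptic] [W.IsGloballyMinimal],
    ¬ W.HasCM → GoodOrd W 2 → ¬ W.HasIrreducibleModPGaloisRep 2 →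
    ∀ (K : Type) [Field K] [NumberField K],
      (IsImaginaryQuadratic K ∧ SatisfiesHeegnerHypothesis (2 * W.conductorNorm ℤ) K) →
    ∀ [IsCMField K] (ι : PadicAlgCl 2 ≃+* ℂ) (v vbar : HeightOneSpectrum (𝓞 K)) (κ₁ κ₂ : ZpExtension K 2)
    (γ₁ γ₂ : absoluteGaloisGroup K) [Fact (ZpExtension.IsTopGeneratorPair κ₁ κ₂ γ₁ γ₂)]
    [NeZero (W.conductorNorm ℤ)] (f : CuspForm (Gamma0 (W.conductorNorm ℤ)) 2),
    ModularForms.IsNewformOf W f → ∀ [NeZero (NumberField.discr K).natAbs],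
    ((2 : ℕ) : 𝓞 K) ∈ v.asIdeal → ((2 : ℕ) : 𝓞 K) ∈ vbar.asIdeal → vbar ≠ v →
    (∀ (w : InfinitePlace K) (k : 𝓞 K), k ∈ v.asIdeal ↔ ‖ι.symm (w.embedding (k : K))‖ < 1) →
    ∀ (Ω δ : ℂ) (Ωp : (unrIntegers 2)ˣ) (LK G₀ : Rcpt),
      IsKatzMeasure₂ ι v vbar ∅ κ₁ κ₂ γ₁⁻¹ γ₂⁻¹ 1 Ω δ ((Ωp : unrIntegers 2) : ℂ_[2]) LK →
      IsGreenbergLFunctionFree₂ ι v vbar κ₁ κ₂ γ₁⁻¹ γ₂⁻¹ f (NumberField.discr K).natAbs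
        (NumberField.classNumber K) LK G₀ →
      ∃ n m : ℕ, IsUnit (PowerSeries.coeff m (PowerSeries.coeff n G₀)) := by
  intro W _ _ hCM hGO hβ K _ _ hK _ ι v vbar κ₁ κ₂ γ₁ γ₂ _ _ f hf _ hv hvbar hne hι Ω δ Ωp LK G₀ hLK hG₀
  exact exists_isUnit_coeff_of_red₂_ne_zero
    (h W hCM hGO hβ K hK ι v vbar κ₁ κ₂ γ₁ γ₂ f hf hv hvbar hne hι Ω δ Ωp LK G₀ hLK hG₀).2.1

/-! ## §4 Registered stubs and the kernel-checked composition to the crux BY NAME -/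

/-- **stub A (O2♭, BY NAME the cell's fallback; BARRIER / IDEA-NEEDED leaf).** -/
theorem stub_twoPowerSlackLowerInclusion : TwoPowerSlackLowerInclusionAtTwo := by
  sorry

/-- **stub B (INT2; INSTRUMENTABLE leaf).** -/
theorem stub_greenbergFunctionIntegral : GreenbergFunctionIntegralAtTwo := by
  sorry

/-- **stub C1 (UMZ2: `𝒪^ur`-rationality ∧ analytic `μ = 0` of the exact frame; INSTRUMENTABLE leaf; the `μ = 0`
half is a conjunct of RES2).** -/
theorem stub_greenbergFunctionUnrMuZero : GreenbergFunctionUnrMuZeroAtTwo := by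
  sorry

/-- **stub C2 (SAT(alg): pure commutative algebra over the valuation ring `𝒪_{ℂ₂}`; ATTACKABLE now — any prover may
land it `--supports stmt-BirchSwinnertonDyer-24728`).** -/
theorem stub_saturatedOfUnrDichotomy : SaturatedOfUnrDichotomy := by
  sorry

/-- Two-power stripping inside a `2`-saturated ideal. [folklore] -/
theorem mem_of_two_pow_mul_mem {I : Ideal Rcpt} (hsat : ∀ X : Rcpt, 2 * X ∈ I → X ∈ I) :
    ∀ (b : ℕ) (X : Rcpt), (2 : Rcpt) ^ b * X ∈ I → X ∈ I := by
  intro b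
  induction b with
  | zero => intro X hX; simpa using hX
  | succ b ih =>
      intro X hX
      have h2 : (2 : Rcpt) ^ b * (2 * X) ∈ I := by
        have : (2 : Rcpt) ^ (b + 1) * X = (2 : Rcpt) ^ b * (2 * X) := by ring
        rw [this] at hX; exact hX
      exact hsat X (ih (2 * X) h2)

/-- **The NODE for O2 as typed, as one `Prop`**: O2♭ → INT2 → UMZ2 → SAT(alg) → `BDPSelmerLowerDivisibilityAtTwo`.  (Named so that
the only theorem of this file concluding the crux BY NAME is the hypothesis-free composition below — skeleton-audit layer rule.) -/
def NodeO2 : Prop :=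
  TwoPowerSlackLowerInclusionAtTwo → GreenbergFunctionIntegralAtTwo → GreenbergFunctionUnrMuZeroAtTwo →
    SaturatedOfUnrDichotomy → BDPSelmerLowerDivisibilityAtTwo

/-- **The node holds (kernel, no `sorry`).**  Descend the `2^a`-scaled frame of O2♭ to the exact frame `G₀` (INT2), push the
`2^b`-slack inclusion into `(G₀)` (`(2^a·G₀) ⊆ (G₀)`), strip `2^b` by saturation (SAT2 := UMZ2 ∧ SAT(alg)). [folklore] -/
theorem nodeO2 : NodeO2 := by
  intro hA hB hC1 hC2 W _ _ hCM hGO hβ K _ _ hK _ ι v vbar κ₁ κ₂ γ₁ γ₂ _ _ f hf _ hv hvbar hne hι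
  have hC : GreenbergFunctionSaturatedAtTwo := greenbergFunctionSaturatedAtTwo_of hC1 hC2
  obtain ⟨a, b, Ω, δ, Ωp, LK, G, hΩ, hδ, hLK, hG, htor, hincl⟩ :=
    hA W hCM hGO hβ K hK ι v vbar κ₁ κ₂ γ₁ γ₂ f hf hv hvbar hne hι
  obtain ⟨G₀, hG₀, hGG₀⟩ :=
    hB W hCM hGO hβ K hK ι v vbar κ₁ κ₂ γ₁ γ₂ f hf hv hvbar hne hι a Ω δ Ωp LK G hLK hG
  have hsat := hC W hCM hGO hβ K hK ι v vbar κ₁ κ₂ γ₁ γ₂ f hf hv hvbar hne hι Ω δ Ωp LK G₀ hLK hG₀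
  refine ⟨Ω, δ, Ωp, LK, G₀, hΩ, hδ, hLK, hG₀, htor, fun J hJ => ?_⟩
  intro x hx
  have h1 : (2 : Rcpt) ^ b * x ∈ Ideal.span {G} :=
    hincl J hJ (Ideal.mul_mem_mul (Ideal.mem_span_singleton_self _) hx)
  have hle : Ideal.span {G} ≤ Ideal.span {G₀} := by
    rw [hGG₀]
    exact Ideal.span_singleton_le_span_singleton.2 (dvd_mul_left G₀ _)
  exact mem_of_two_pow_mul_mem hsat b x (hle h1)

/-- **THE SKELETON THEOREM — hypothesis-free composition concluding the crux `BDPSelmerLowerDivisibilityAtTwo` (route decl BY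
NAME); `sorry` only inside the four registered `stub_*`.** -/
theorem BDPSelmerLowerDivisibilityAtTwo_of : BDPSelmerLowerDivisibilityAtTwo :=
  nodeO2 stub_twoPowerSlackLowerInclusion stub_greenbergFunctionIntegral stub_greenbergFunctionUnrMuZero
    stub_saturatedOfUnrDichotomy

/-! ## §5 Kernel links recording the tags -/

/-- Variant node in SAT2 currency: O2♭ → INT2 → SAT2 → O2 (SAT2 from any source, e.g. a future `μ = 0` theorem at `2`). -/
def NodeO2Sat : Prop :=
  TwoPowerSlackLowerInclusionAtTwo → GreenbergFunctionIntegralAtTwo → GreenbergFunctionSaturatedAtTwo →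
    BDPSelmerLowerDivisibilityAtTwo

/-- The SAT2-currency node holds (kernel). [folklore] -/
theorem nodeO2Sat : NodeO2Sat := by
  intro hA hB hC W _ _ hCM hGO hβ K _ _ hK _ ι v vbar κ₁ κ₂ γ₁ γ₂ _ _ f hf _ hv hvbar hne hι
  obtain ⟨a, b, Ω, δ, Ωp, LK, G, hΩ, hδ, hLK, hG, htor, hincl⟩ :=
    hA W hCM hGO hβ K hK ι v vbar κ₁ κ₂ γ₁ γ₂ f hf hv hvbar hne hι
  obtain ⟨G₀, hG₀, hGG₀⟩ :=
    hB W hCM hGO hβ K hK ι v vbar κ₁ κ₂ γ₁ γ₂ f hf hv hvbar hne hι a Ω δ Ωp LK G hLK hG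
  have hsat := hC W hCM hGO hβ K hK ι v vbar κ₁ κ₂ γ₁ γ₂ f hf hv hvbar hne hι Ω δ Ωp LK G₀ hLK hG₀
  refine ⟨Ω, δ, Ωp, LK, G₀, hΩ, hδ, hLK, hG₀, htor, fun J hJ => ?_⟩
  intro x hx
  have h1 : (2 : Rcpt) ^ b * x ∈ Ideal.span {G} :=
    hincl J hJ (Ideal.mul_mem_mul (Ideal.mem_span_singleton_self _) hx)
  have hle : Ideal.span {G} ≤ Ideal.span {G₀} := by
    rw [hGG₀]
    exact Ideal.span_singleton_le_span_singleton.2 (dvd_mul_left G₀ _)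
  exact mem_of_two_pow_mul_mem hsat b x (hle h1)

/-- O2 ⟹ O2♭ (so stub A is WEAKER than the crux; `a = b = 0`). [folklore] -/
theorem twoPowerSlackLowerInclusionAtTwo_of_bdp (h : BDPSelmerLowerDivisibilityAtTwo) :
    TwoPowerSlackLowerInclusionAtTwo := by
  intro W _ _ hCM hGO hβ K _ _ hK _ ι v vbar κ₁ κ₂ γ₁ γ₂ _ _ f hf _ hv hvbar hne hι
  obtain ⟨Ω, δ, Ωp, LK, G, hΩ, hδ, hLK, hG, htor, hincl⟩ := h W hCM hGO hβ K hK ι v vbar κ₁ κ₂ γ₁ γ₂ f hf hv hvbar hne hι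
  refine ⟨0, 0, Ω, δ, Ωp, LK, G, hΩ, hδ, hLK, by simpa using hG, htor, fun J hJ => ?_⟩
  rw [pow_zero, Ideal.span_singleton_one, Ideal.top_mul]
  exact hincl J hJ

end Summit.BirchSwinnertonDyer.BirchSwinnertonDyer.Cruxes.BDPSelmerLowerDivisibilityAtTwo.SpecialFibreSquareTwo
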